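import Literature.Analysis.Matrix.KyFanMaximumPrinciple

/-!
# Weighted row-sum (Collatz–Wielandt / Schur) bound for the top eigenvalue of a non-negative symmetric matrix

Horn–Johnson, *Matrix Analysis* (2nd ed., CUP 2013), **Theorem 8.1.26 / Corollary 8.1.29**: for a
matrix `A ≥ 0` (entrywise) and any positive vector `x`,
`ρ(A) ≤ max_i (A x)_i / x_i` (and `min_i (Ax)_i/x_i ≤ ρ(A)`). For REAL SYMMETRIC `A ≥ 0` the
spectral radius is the top eigenvalue `λ_1↓(A)` (Rayleigh, Thm. 4.2.2), so the statement proved here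
is: if `S` is real symmetric with non-negative entries and `p > 0` satisfies `Σ_m S_{nm} p_m ≤ θ p_n`
for every `n`, then `xᵀ S x ≤ θ xᵀx` for all `x` (`dotProduct_mulVec_le_of_weightedRowSum_le`) and
`λ_1↓(S) ≤ θ` (`eigenvalues₀_max_le_of_weightedRowSum_le`, with Mathlib's decreasingly sorted
`Matrix.IsHermitian.eigenvalues₀` and the attainment half of `KyFanMaximumPrinciple`). The proof is
the weighted Schur test: `S_{nm} x_n x_m ≤ S_{nm} (x_n² p_m/p_n + x_m² p_n/p_m)/2` and the two halves
coincide after `n ↔ m`. (The unweighted case `p ≡ 1` is Gershgorin's row-sum bound; the weighted form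
is what makes diagonal-similarity scalings `D⁻¹ S D` available without leaving symmetric matrices.)
Used by `Literature/MathematicalPhysics/QuantumManyBody/EliashbergTcCeiling`.

## References
* [HornJohnson2013] R. A. Horn, C. R. Johnson, *Matrix Analysis*, 2nd ed., CUP 2013 — Thm. 8.1.26,
  Cor. 8.1.29 (Collatz–Wielandt bounds), Thm. 4.2.2 (Rayleigh), §5.6 (Schur test).
-/

noncomputable section

open scoped Matrix

namespace Literature.Analysis.Matrix

open Finset _root_.Matrix

variable {ι : Type*} [Fintype ι] [DecidableEq ι]

/-- Weighted AM–GM: `ab ≤ (a² q/p + b² p/q)/2` for `p, q > 0` (it is `(aq − bp)² ≥ 0`). [folklore] -/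
private theorem mul_le_weighted_sq (a b : ℝ) {p q : ℝ} (hp : 0 < p) (hq : 0 < q) :
    a * b ≤ (a ^ 2 * q / p + b ^ 2 * p / q) / 2 := by
  rw [le_div_iff₀ (by norm_num : (0:ℝ) < 2), div_add_div _ _ hp.ne' hq.ne',
    le_div_iff₀ (mul_pos hp hq)]
  nlinarith [sq_nonneg (a * q - b * p), mul_pos hp hq]

omit [DecidableEq ι] in
/-- **Weighted row-sum test for the quadratic form.** If `S` is real symmetric with non-negative
entries and `p` is a positive vector with `Σ_m S_{nm} p_m ≤ θ p_n` for every `n`, then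
`xᵀ S x ≤ θ xᵀ x` for every `x`: by weighted AM–GM, `S_{nm} x_n x_m ≤ S_{nm}(x_n² p_m/p_n + x_m² p_n/p_m)/2`,
and the two halves are equal after `n ↔ m`. [cite: HornJohnson2013, Thm. 8.1.26] -/
theorem dotProduct_mulVec_le_of_weightedRowSum_le {S : Matrix ι ι ℝ} (hS : S.IsHermitian)
    (h0 : ∀ n m, 0 ≤ S n m) {p : ι → ℝ} (hp : ∀ n, 0 < p n) {θ : ℝ}
    (hrow : ∀ n, ∑ m, S n m * p m ≤ θ * p n) (x : ι → ℝ) :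
    x ⬝ᵥ S *ᵥ x ≤ θ * (x ⬝ᵥ x) := by
  have hsym : ∀ n m, S m n = S n m := fun n m => by simpa using hS.apply n m
  have hexp : x ⬝ᵥ S *ᵥ x = ∑ n, ∑ m, S n m * (x n * x m) := by
    simp only [dotProduct, mulVec, Finset.mul_sum]
    exact Finset.sum_congr rfl fun n _ => Finset.sum_congr rfl fun m _ => by ring
  set F : ι → ι → ℝ := fun n m => S n m * (x n ^ 2 * p m / p n) with hF
  have hbound : ∀ n m, S n m * (x n * x m) ≤ (F n m + F m n) / 2 := fun n m => by
    have h := mul_le_mul_of_nonneg_left (mul_le_weighted_sq (x n) (x m) (hp n) (hp m)) (h0 n m)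
    have e : S n m * ((x n ^ 2 * p m / p n + x m ^ 2 * p n / p m) / 2) = (F n m + F m n) / 2 := by
      simp only [hF, hsym n m]; ring
    linarith
  have hswap : ∑ n, ∑ m, F m n = ∑ n, ∑ m, F n m := Finset.sum_comm
  have hrowF : ∀ n, ∑ m, F n m ≤ θ * x n ^ 2 := fun n => by
    have hpn : p n ≠ 0 := (hp n).ne'
    have e : ∑ m, F n m = (x n ^ 2 / p n) * ∑ m, S n m * p m := by
      rw [Finset.mul_sum]
      exact Finset.sum_congr rfl fun m _ => by simp only [hF]; field_simp
    rw [e]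
    calc x n ^ 2 / p n * ∑ m, S n m * p m ≤ x n ^ 2 / p n * (θ * p n) :=
          mul_le_mul_of_nonneg_left (hrow n) (div_nonneg (sq_nonneg _) (hp n).le)
      _ = θ * x n ^ 2 := by field_simp
  rw [hexp]
  calc ∑ n, ∑ m, S n m * (x n * x m) ≤ ∑ n, ∑ m, (F n m + F m n) / 2 :=
        Finset.sum_le_sum fun n _ => Finset.sum_le_sum fun m _ => hbound n m
    _ = ((∑ n, ∑ m, F n m) + ∑ n, ∑ m, F m n) / 2 := by
        have e : ∀ n, ∑ m, (F n m + F m n) / 2 = ((∑ m, F n m) + ∑ m, F m n) / 2 := fun n => by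
          rw [← Finset.sum_add_distrib, Finset.sum_div]
        rw [Finset.sum_congr rfl fun n _ => e n, ← Finset.sum_div, Finset.sum_add_distrib]
    _ = ∑ n, ∑ m, F n m := by rw [hswap]; ring
    _ ≤ ∑ n, θ * x n ^ 2 := Finset.sum_le_sum fun n _ => hrowF n
    _ = θ * (x ⬝ᵥ x) := by
        rw [← Finset.mul_sum]
        simp only [dotProduct, pow_two]

/-- **Collatz–Wielandt upper bound for the top eigenvalue**: under the hypotheses of
`dotProduct_mulVec_le_of_weightedRowSum_le`, `λ_max(S) ≤ θ`. [cite: HornJohnson2013, Cor. 8.1.29] -/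
theorem eigenvalues₀_max_le_of_weightedRowSum_le {S : Matrix ι ι ℝ} (hS : S.IsHermitian)
    (h0 : ∀ n m, 0 ≤ S n m) {p : ι → ℝ} (hp : ∀ n, 0 < p n) {θ : ℝ}
    (hrow : ∀ n, ∑ m, S n m * p m ≤ θ * p n) (hn : 1 ≤ Fintype.card ι) :
    hS.eigenvalues₀ (Fin.castLE hn 0) ≤ θ := by
  obtain ⟨h, horth, -, hsum⟩ := KyFan.exists_frame_sum_rayleigh_eq hS (k := 1) hn
  have hunit : h 0 ⬝ᵥ h 0 = 1 := by simpa using horth 0 0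
  have hval : h 0 ⬝ᵥ S *ᵥ h 0 = hS.eigenvalues₀ (Fin.castLE hn 0) := by simpa using hsum
  rw [← hval]
  have := dotProduct_mulVec_le_of_weightedRowSum_le hS h0 hp hrow (h 0)
  rwa [hunit, mul_one] at this

end Literature.Analysis.Matrix
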